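import Literature.AnabelianGeometry.SemiGraphs.TemperedAnabelianMorphisms

/-!
# [SemiAnbd] Theorem 6.4 (Tempered Anabelian Theorem for Hyperbolic Curves over Local Fields):
# the printed proof cut into intermediate STATEMENTS (sub-DAG, statements-first)

Mochizuki, *Semi-graphs of anabelioids*, Publ. RIMS **42** (2006) [SemiAnbd], §6, author's
manuscript (kurims) p. 70 l. −9 – p. 71 l. 2 (statement) and p. 71 ll. 3–11 (proof).
[cite: MochizukiSemiAnbd2006, Thm 6.4 pp.70-71]

Cell context (abc-iut, human ruling D-0068 (1) «decompose recursively, statements-first»; L3-lead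
SUBDAG-WANTED row `SemiAnbd:Thm6.4`, 2026-08-26T00:06Z).  The node is typed in
`TemperedAnabelianMorphisms.lean` as the predicate `TemperedAnabelianTheorem C` on the interface datum
`C : TemperedCurveHom p X Y` (the set of dominant morphisms `X_K → Y_L` with the tempered-`π₁`
functor) and, as printed, `TemperedMorphismOrigin.TemperedAnabelianTheoremHolds Ω`.  THIS FILE types
the SENTENCES OF THE PRINTED PROOF as named `Prop`s over the same interface (`TemperedCurve p` of
`TemperedAnabelian.lean`: `Π^temp`, its profinite completion `toHat : Π^temp → Π`, the augmentations
`aug`, `augHat`), one per step, and PROVES the assembly `temperedAnabelianTheorem_of_steps`: the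
printed argument, with every sentence a named hypothesis, yields `TemperedAnabelianTheorem C` in the
kernel.  Every step is OUR paraphrase of a sentence of the printed proof and is an OPEN sub-node (to be
proved, or — for the interface-level / [Mzk8] steps — consumed by name); none is a fact, nothing is
asserted.  The printed proof, verbatim (p. 71):

  "One verifies immediately from the definition of the 'tempered fundamental group' that any
  `Π^temp_{X_K} → Π^temp_{Y_L}` that arises geometrically is of DFG-type, hence, by Lemma 6.3, (ii), of
  DOF-type.  On the other hand, given a homomorphism `φ : Π^temp_{X_K} → Π^temp_{Y_L}` of DOF-type,
  profinite completion yields an open homomorphism `φ̂ : Π_{X_K} → Π_{Y_L}`, so by [Mzk8], Theorem 1.2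
  [i.e., in essence, [Mzk2], Theorem A], we obtain that `φ̂` arises, up to inner automorphism, from a
  dominant morphism of schemes `X_K → Y_L`.  In particular, this dominant morphism of schemes induces
  a homomorphism `ψ : Π^temp_{X_K} → Π^temp_{Y_L}` of DOF-type, whose profinite completion
  `ψ̂ : Π_{X_K} → Π_{Y_L}` differs from `φ̂` by composition with an inner automorphism of `Π_{Y_L}`.  On
  the other hand, by Lemma 6.3, (iii), we thus conclude that `φ` differs from `ψ` by composition with
  an inner automorphism of `Π^temp_{Y_L}`, as desired."

The cut (ids as on the L3 board `plan/L3/SUBDAG-SemiAnbd-Thm64.md`):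
* T64-L01 `GeometricIsDFG` — sentence 1, first half (interface level: the tempered-`π₁` functor);
* T64-L01b `GeometricIsGaloisCompatible` — the diagram over `G_K → G_L` for a geometric map (implicit
  in the statement p. 70; interface level);
* T64-L02 = Lemma 6.3 (ii) for `Π^temp_{Y_L}` — the tree's `TemperedCurve.PiTempDFGIffDOF Y`;
* T64-L03a `CompletionExtends` / T64-L03b `CompletionOpenOfDOF` — sentence 2, "profinite completion
  yields an open homomorphism" (classical topological group theory over `IsProfiniteCompletion`;
  provable); T64-L03c `completion_galoisCompatible` — the diagram passes to completions (PROVED here);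
* T64-L04 `ProfiniteAnabelianTheorem` — [Mzk8] Thm. 1.2 (Mochizuki, *Galois sections in absolute
  anabelian geometry*, Nagoya Math. J. **179** (2005), Thm. 1.2 p. 5: "The étale fundamental group
  functor determines a bijection between the set of dominant morphisms of schemes `X_K → Y_L` and the
  set of open outer homomorphisms `φ : Π_{X_K} → Π_{Y_L}` that fit into a commutative diagram [over]
  `G_K → G_L` [an open immersion arising from `L ↪ K`]") read on the dense subgroups
  `Π^temp ↪ Π` through the naturality `(π₁^temp)^∧ = π₁^ét` (p. 69 "natural injections", [André] §4.5)
  — a DEEP INPUT of FACT-policy class ([Mzk8] Thm. 1.2 ⇐ [pGC] Thm. A; the tree's one-base-field form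
  is `Literature.AnabelianGeometry.AbsoluteAnabelian.pGC.ThmA`), typed here as an intermediate
  STATEMENT only; sentences 2–3;
* T64-L07 `OuterDescent` — the concluding inference of sentences 3–4 ("by Lemma 6.3, (iii), we thus
  conclude"), and T64-L06′ `OpenDenseDOFConjugator` = Lemma 6.3 (iii) in the generality the inference
  uses (for the open subgroups of finite index of `Π^temp_{Y_L}`, i.e. the tempered fundamental groups
  of the finite étale coverings of `Y_L`), from which T64-L07 is to be derived (open sub-node);
* T64-L00 `temperedAnabelianTheorem_of_steps` — the assembly, PROVED.
No statement of [SemiAnbd] is strengthened; nothing here takes a side on [IUTchIII] Cor. 3.12.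
-/

noncomputable section

namespace Literature.AnabelianGeometry.SemiGraphs

open scoped Pointwise
open Topology

namespace TemperedCurve

variable {p : ℕ} [Fact p.Prime]

/-! ### T64-L01, T64-L01b: what "arises geometrically" gives (interface level) -/

/-- **T64-L01** ([SemiAnbd] Thm. 6.4, proof p. 71 ll. 3–4): "One verifies immediately from the
definition of the 'tempered fundamental group' that any `Π^temp_{X_K} → Π^temp_{Y_L}` that arises
geometrically is of DFG-type."  Interface level (the tempered-`π₁` functor `C.pi1` is data of
`TemperedCurveHom`; André's construction is not in the tree -- TODO-merge: abc-iut-L3-t2).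
Sub-node of `SemiAnbd:Thm6.4`, OUR cut; not a fact. [cite: MochizukiSemiAnbd2006, Thm 6.4 proof p.71] -/
def GeometricIsDFG {X Y : TemperedCurve p} (C : TemperedCurveHom p X Y) : Prop :=
  ∀ f : C.DomHom, IsDFGTypeHom Y.toHat (C.pi1 f)

/-- **T64-L01b** ([SemiAnbd] Thm. 6.4, statement p. 70 l. −4 – p. 71 l. 2): a homomorphism arising
from a dominant morphism of schemes `X_K → Y_L` "fit[s] into a commutative diagram" over a morphism
`G_K → G_L` which "is an open immersion which arises from an embedding of fields `L ↪ K`" — the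
embedding being the one underlying the morphism of schemes (rendered, as in
`IsGaloisCompatibleDOFHom`, by `g ∈ G_{ℚ_p}` with `g(L) ⊆ K`, `G_K → G_L`, `h ↦ g⁻¹ h g`).  Interface
level -- TODO-merge: abc-iut-L3-t2 / abc-iut-L4-t1. Sub-node, OUR cut; not a fact.
[cite: MochizukiSemiAnbd2006, Thm 6.4 pp.70-71] -/
def GeometricIsGaloisCompatible {X Y : TemperedCurve p} (C : TemperedCurveHom p X Y) : Prop :=
  ∀ f : C.DomHom, ∃ g : GQp p,
    IntermediateField.map (g : AlgebraicClosure ℚ_[p] →ₐ[ℚ_[p]] AlgebraicClosure ℚ_[p]) Y.K ≤ X.K ∧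
      ∀ x : X.PiTemp, Y.aug (C.pi1 f x) = g⁻¹ * X.aug x * g

/-! ### T64-L03: "profinite completion yields an open homomorphism" -/

/-- **T64-L03a** ([SemiAnbd] Thm. 6.4, proof p. 71 l. 5 "profinite completion yields …
`φ̂ : Π_{X_K} → Π_{Y_L}`"): every continuous homomorphism `φ : Π^temp_{X_K} → Π^temp_{Y_L}` extends
along the completions `Π^temp ↪ Π` to a continuous homomorphism `φ̂ : Π_{X_K} → Π_{Y_L}` (unique by
density — `completion_unique`).  Classical (universal property of the profinite completion, here to
be derived from the interface axioms `IsProfiniteCompletion`); OPEN sub-node, provable.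
[cite: MochizukiSemiAnbd2006, Thm 6.4 proof p.71] -/
def CompletionExtends (X Y : TemperedCurve p) : Prop :=
  ∀ φ : X.PiTemp →ₜ* Y.PiTemp, ∃ Φ : X.PiHat →ₜ* Y.PiHat, ∀ x : X.PiTemp, Φ (X.toHat x) = Y.toHat (φ x)

/-- **T64-L03b** ([SemiAnbd] Thm. 6.4, proof p. 71 ll. 4–5): "given a homomorphism
`φ : Π^temp_{X_K} → Π^temp_{Y_L}` of DOF-type, profinite completion yields an OPEN homomorphism
`φ̂ : Π_{X_K} → Π_{Y_L}`" — an extension of a DOF-type `φ` has open image.  Classical topological group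
theory (image dense in an open subgroup of finite index `U`; the closure of `U` in `Π_{Y_L}` is open);
OPEN sub-node, provable. [cite: MochizukiSemiAnbd2006, Thm 6.4 proof p.71] -/
def CompletionOpenOfDOF (X Y : TemperedCurve p) : Prop :=
  ∀ (φ : X.PiTemp →ₜ* Y.PiTemp) (Φ : X.PiHat →ₜ* Y.PiHat),
    (∀ x : X.PiTemp, Φ (X.toHat x) = Y.toHat (φ x)) → IsDOFTypeHom φ → IsOpen (Set.range Φ)

/-- Uniqueness half of T64-L03a, PROVED: two continuous homomorphisms `Π_{X_K} → Π_{Y_L}` agreeing on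
`Π^temp_{X_K}` are equal (density of `Π^temp_{X_K} ↪ Π_{X_K}`, `Π_{Y_L}` Hausdorff — both from
`IsProfiniteCompletion`). [cite: MochizukiSemiAnbd2006, §6 p.69] -/
theorem completion_unique (X Y : TemperedCurve p) (Φ Ψ : X.PiHat →ₜ* Y.PiHat)
    (h : ∀ x : X.PiTemp, Φ (X.toHat x) = Ψ (X.toHat x)) : Φ = Ψ := by
  haveI : T2Space Y.PiHat := Y.isProfiniteCompletion_toHat.t2Space
  have hd : DenseRange X.toHat := X.isProfiniteCompletion_toHat.denseRange
  have heq : (Φ : X.PiHat → Y.PiHat) = Ψ :=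
    Continuous.ext_on hd Φ.continuous Ψ.continuous fun y ⟨x, hx⟩ => by subst hx; exact h x
  exact ContinuousMonoidHom.ext fun z => congrFun heq z

/-- **T64-L03c**, PROVED: the commutative diagram over `G_K → G_L` (`h ↦ g⁻¹ h g`) for `φ` passes to
any extension `φ̂` of `φ` to the profinite completions (density of `Π^temp_{X_K}` in `Π_{X_K}`,
continuity of the augmentations, `augHat ∘ toHat = aug`, `G_{ℚ_p}` Hausdorff in the Krull topology).
[cite: MochizukiSemiAnbd2006, Thm 6.4 proof p.71] -/
theorem completion_galoisCompatible (X Y : TemperedCurve p) (φ : X.PiTemp →ₜ* Y.PiTemp)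
    (Φ : X.PiHat →ₜ* Y.PiHat) (hΦ : ∀ x : X.PiTemp, Φ (X.toHat x) = Y.toHat (φ x)) (g : GQp p)
    (hg : ∀ x : X.PiTemp, Y.aug (φ x) = g⁻¹ * X.aug x * g) :
    ∀ z : X.PiHat, Y.augHat (Φ z) = g⁻¹ * X.augHat z * g := by
  haveI : T2Space (GQp p) := krullTopology_t2
  have hd : DenseRange X.toHat := X.isProfiniteCompletion_toHat.denseRange
  have h1 : Continuous fun z : X.PiHat => Y.augHat (Φ z) := Y.augHat.continuous.comp Φ.continuous
  have h2 : Continuous fun z : X.PiHat => g⁻¹ * X.augHat z * g :=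
    (continuous_const.mul X.augHat.continuous).mul continuous_const
  have heq := Continuous.ext_on hd h1 h2 fun y ⟨x, hx⟩ => by
    subst hx
    show Y.augHat (Φ (X.toHat x)) = g⁻¹ * X.augHat (X.toHat x) * g
    rw [hΦ, Y.augHat_comp, X.augHat_comp, hg]
  exact fun z => congrFun heq z

/-! ### T64-L04: [Mzk8] Theorem 1.2 (the profinite anabelian theorem), read on `Π^temp ↪ Π` -/

/-- The condition of [Mzk8] Thm. 1.2 on a continuous homomorphism `Φ : Π_{X_K} → Π_{Y_L}` of the
profinite completions: `Φ` is OPEN (open image) and fits into a commutative diagram over a morphism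
`G_K → G_L` which "is an open immersion which arises from an embedding of fields `L ↪ K`" (same
rendering as `IsGaloisCompatibleDOFHom`). [cite: MochizukiSemiAnbd2006, Thm 6.4 proof p.71] -/
def IsGaloisCompatibleOpenHatHom (X Y : TemperedCurve p) (Φ : X.PiHat →ₜ* Y.PiHat) : Prop :=
  IsOpen (Set.range Φ) ∧ ∃ g : GQp p,
    IntermediateField.map (g : AlgebraicClosure ℚ_[p] →ₐ[ℚ_[p]] AlgebraicClosure ℚ_[p]) Y.K ≤ X.K ∧
      ∀ z : X.PiHat, Y.augHat (Φ z) = g⁻¹ * X.augHat z * g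

/-- **T64-L04** = [Mzk8] Theorem 1.2 (Mochizuki, *Galois sections in absolute anabelian geometry*,
Nagoya Math. J. 179 (2005), p. 5), as the printed proof of [SemiAnbd] Thm. 6.4 invokes it (p. 71
ll. 5–8: "by [Mzk8], Theorem 1.2 [i.e., in essence, [Mzk2], Theorem A], we obtain that `φ̂` arises,
up to inner automorphism, from a dominant morphism of schemes `X_K → Y_L` … this dominant morphism of
schemes induces a homomorphism `ψ` … whose profinite completion `ψ̂` differs from `φ̂` by composition
with an inner automorphism of `Π_{Y_L}`"): "The étale fundamental group functor determines a
bijection between the set of dominant morphisms of schemes `X_K → Y_L` and the set of open outer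
homomorphisms `φ : Π_{X_K} → Π_{Y_L}` that fit into a commutative diagram [over `G_K → G_L`, an open
immersion arising from `L ↪ K`]."  READ ON THE DENSE SUBGROUPS `Π^temp ↪ Π` via the naturality
`(π₁^temp(f))^∧ = π₁^ét(f)` (p. 69 "natural injections `Π^temp_{X_K} ↪ Π_{X_K}`", [André] §4.5): an
open `Φ` over such a `G_K → G_L` agrees on `Π^temp_{X_K}`, up to a `Π_{Y_L}`-conjugation, with
`π₁^temp(f)` for some dominant `f` (surjectivity), and `f` is determined by the `Π_{Y_L}`-conjugacy
class of `π₁^temp(f)` viewed in `Π_{Y_L}` (injectivity).  DEEP INPUT of FACT-policy class (rests on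
[pGC] Thm. A; the tree's one-base-field relative form is
`Literature.AnabelianGeometry.AbsoluteAnabelian.pGC.ThmA`), typed as an intermediate STATEMENT of
the sub-DAG only; never asserted. -- TODO-merge: abc-iut-L4-t1 (étale `π₁` functor), abc-iut-L3-t2.
[cite: MochizukiSemiAnbd2006, Thm 6.4 proof p.71] -/
def ProfiniteAnabelianTheorem {X Y : TemperedCurve p} (C : TemperedCurveHom p X Y) : Prop :=
  (∀ Φ : X.PiHat →ₜ* Y.PiHat, IsGaloisCompatibleOpenHatHom X Y Φ →
    ∃ f : C.DomHom, ∃ c : Y.PiHat, ∀ x : X.PiTemp, Φ (X.toHat x) = c * Y.toHat (C.pi1 f x) * c⁻¹) ∧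
  (∀ f f' : C.DomHom,
    (∃ c : Y.PiHat, ∀ x : X.PiTemp, Y.toHat (C.pi1 f' x) = c * Y.toHat (C.pi1 f x) * c⁻¹) → f = f')

/-! ### T64-L06′, T64-L07: "by Lemma 6.3, (iii), we thus conclude" -/

/-- **T64-L06′** = [SemiAnbd] Lemma 6.3 (iii) (p. 70) in the generality the last sentence of the proof
of Thm. 6.4 uses it: for every OPEN SUBGROUP OF FINITE INDEX `U ⊆ Π^temp_{Y_L}` (the tempered
fundamental group of a finite étale covering of `Y_L`; print states 6.3 (iii) "for `F` either
`Π^temp_{X_K}` or `Δ^temp_X`", and 6.3 (ii)'s proof passes to such open subgroups: "by replacing `F` by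
an open subgroup of `F` of finite index"), with `Û` = the closure of `U` in `Π_{Y_L}`: "Suppose that
`F₁, F₂ ⊆ U` are subgroups of DOF-type which are dense in `Û`. Then, for any `f ∈ Û` such that
`f · F₁ · f⁻¹ = F₂`, it follows that `f ∈ U`."  (For `U = Π^temp_{Y_L}` this is the tree's
`PiTempDenseDOFConjugator Y`.)  Sub-node, OUR cut (to be proved from Lem. 6.1 / [André] or consumed
by name); not a fact. [cite: MochizukiSemiAnbd2006, Lem 6.3(iii) p.70] -/
def OpenDenseDOFConjugator (Y : TemperedCurve p) : Prop :=
  ∀ U : Subgroup Y.PiTemp, IsOpen (U : Set Y.PiTemp) → U.FiniteIndex →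
    ∀ F₁ F₂ : Subgroup Y.PiTemp, F₁ ≤ U → F₂ ≤ U → IsDOFType F₁ → IsDOFType F₂ →
      closure (Y.toHat '' (F₁ : Set Y.PiTemp)) = closure (Y.toHat '' (U : Set Y.PiTemp)) →
      closure (Y.toHat '' (F₂ : Set Y.PiTemp)) = closure (Y.toHat '' (U : Set Y.PiTemp)) →
      ∀ c : Y.PiHat, c ∈ closure (Y.toHat '' (U : Set Y.PiTemp)) →
        (ConjAct.toConjAct c) • F₁.map Y.toHat.toMonoidHom = F₂.map Y.toHat.toMonoidHom →
          c ∈ Y.toHat '' (U : Set Y.PiTemp)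

/-- **T64-L07** ([SemiAnbd] Thm. 6.4, proof p. 71 ll. 8–11, the concluding inference): two DOF-type
homomorphisms `φ, ψ : Π^temp_{X_K} → Π^temp_{Y_L}` whose profinite completions "differ by composition
with an inner automorphism of `Π_{Y_L}`" (equivalently, by density: `ι_Y ∘ φ = Inn(c) ∘ ι_Y ∘ ψ` for
some `c ∈ Π_{Y_L}`) differ "by composition with an inner automorphism of `Π^temp_{Y_L}`".  Print: "by
Lemma 6.3, (iii)"; the literal application needs `F₁ = Im ψ`, `F₂ = Im φ` dense in the completion,
which holds after passing to the open subgroup `U := closure(Im ψ)` (finite index, DOF) and moving `c`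
into `Û` by a `Π^temp_{Y_L}`-translate (density of `Π^temp_{Y_L}` in `Π_{Y_L}`) — i.e. from T64-L06′;
OPEN sub-node (the reduction T64-L07 ⇐ T64-L06′ is classical and provable).
[cite: MochizukiSemiAnbd2006, Thm 6.4 proof p.71] -/
def OuterDescent (X Y : TemperedCurve p) : Prop :=
  ∀ φ ψ : X.PiTemp →ₜ* Y.PiTemp, IsDOFTypeHom φ → IsDOFTypeHom ψ →
    (∃ c : Y.PiHat, ∀ x : X.PiTemp, Y.toHat (φ x) = c * Y.toHat (ψ x) * c⁻¹) →
      ∃ y : Y.PiTemp, ∀ x : X.PiTemp, φ x = y * ψ x * y⁻¹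

/-! ### T64-L00: the assembly — the printed argument in the kernel, every sentence a named step -/

/-- **T64-L00 (assembly), PROVED**: the printed proof of [SemiAnbd] Theorem 6.4 (p. 71), with each of
its sentences a NAMED hypothesis — T64-L01 `GeometricIsDFG`, T64-L01b `GeometricIsGaloisCompatible`,
T64-L02 = Lemma 6.3 (ii) `Y.PiTempDFGIffDOF`, T64-L03a/b `CompletionExtends` / `CompletionOpenOfDOF`,
T64-L04 `ProfiniteAnabelianTheorem` ([Mzk8] Thm. 1.2), T64-L07 `OuterDescent` (⇐ Lemma 6.3 (iii)) —
yields the typed node `TemperedAnabelianTheorem C` (all three clauses: geometric maps are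
Galois-compatible of DOF-type; every such `φ` is `π₁^temp(f)` up to `Π^temp_{Y_L}`-conjugation;
`π₁^temp` is injective on dominant morphisms up to conjugation).  T64-L03c is discharged inside
(`completion_galoisCompatible`).  Typed ≠ proved for the hypotheses; nothing asserted.
[cite: MochizukiSemiAnbd2006, Thm 6.4 proof p.71] -/
theorem temperedAnabelianTheorem_of_steps {X Y : TemperedCurve p} (C : TemperedCurveHom p X Y)
    (h01 : GeometricIsDFG C) (h01b : GeometricIsGaloisCompatible C) (h02 : Y.PiTempDFGIffDOF)
    (h03a : CompletionExtends X Y) (h03b : CompletionOpenOfDOF X Y)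
    (h04 : ProfiniteAnabelianTheorem C) (h07 : OuterDescent X Y) :
    TemperedAnabelianTheorem C := by
  -- clause (1): geometric ⇒ DFG ⇒ DOF (Lemma 6.3 (ii)), plus the Galois diagram
  have hdof : ∀ f : C.DomHom, IsDOFTypeHom (C.pi1 f) := fun f => (h02 _).mp (h01 f)
  refine ⟨fun f => ⟨hdof f, h01b f⟩, ?_, ?_⟩
  · -- clause (2): DOF `φ` ⇒ open `φ̂` ⇒ ([Mzk8] 1.2) `φ̂ ~ π₁(f)^` ⇒ (OuterDescent) `φ ~ π₁^temp(f)`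
    rintro φ ⟨hφ, g, hgK, hg⟩
    obtain ⟨Φ, hΦ⟩ := h03a φ
    have hopen : IsOpen (Set.range Φ) := h03b φ Φ hΦ hφ
    have hgal := completion_galoisCompatible X Y φ Φ hΦ g hg
    obtain ⟨f, c, hc⟩ := h04.1 Φ ⟨hopen, g, hgK, hgal⟩
    have hc' : ∃ c : Y.PiHat, ∀ x : X.PiTemp, Y.toHat (φ x) = c * Y.toHat (C.pi1 f x) * c⁻¹ :=
      ⟨c, fun x => by rw [← hΦ x, hc x]⟩
    obtain ⟨y, hy⟩ := h07 φ (C.pi1 f) hφ (hdof f) hc'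
    refine ⟨f, y⁻¹, fun x => ?_⟩
    rw [hy x, inv_inv]
    group
  · -- clause (3): injectivity, from the injectivity half of [Mzk8] Thm. 1.2 applied in `Π_{Y_L}`
    rintro f f' ⟨y, hy⟩
    refine h04.2 f f' ⟨Y.toHat y, fun x => ?_⟩
    rw [hy x, map_mul, map_mul, map_inv]

end TemperedCurve

end Literature.AnabelianGeometry.SemiGraphs

end
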